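import Summits.Ventures.LatticeQCDFlow.Exactness.ReversibleVariationalTauInt
import Summits.Ventures.LatticeQCDFlow.Exactness.ReversibleAutocovMonotone
import HarnessLib

/-!
# The variational floor per SWEEP of `V` steps, and with a dominated Dirichlet form: `τ_int^{(V)}(g) ≥ ⟨g, v⟩²/(C_g(0) · V 𝓔(v)) − ½`

HONEST FRAMING: exact (Metropolis-corrected) sampling algorithms for lattice gauge theory;
figures of merit are autocorrelation/cost numbers at stated couplings and volumes; no
continuum-physics claim.  (SCALAR calibration rung S0-A: not a gauge result.)

Venture `LatticeQCDFlow` (cell pub-lqcd), topic `Exactness`; FANOUT row 2 (`s0-phi4`).  NEW WORK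
of the cell, composing `Exactness/ReversibleVariationalFloor.lean` /
`ReversibleVariationalTauInt.lean` (the variational floor `(∫ g v w)² ≤ A_r(g) Q_r(v)` and its
`τ_int` form) with `Exactness/ReversibleAutocovMonotone.lean` (`C_v(0) − C_v(V) ≤ V (C_v(0) − C_v(1))`:
in `V` steps a reversible sampler dissipates at most `V` times its one-step Dirichlet form).
Nothing is cited as a fact.

## Why this file

Row 2's local arm is clocked in SWEEPS (`V = n+1` proposals), i.e. by the reversible contraction
`K^V`; and the trial observables of the lattice files come with an UPPER BOUND on their Dirichlet
form (`𝓔(θ) = 2 r_flip` for a phase label, `𝓔(χ − a) ≤ ε ∫ χ w` for a sticky indicator,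
`𝓔(v) ≤ ½ D ∫ w` under a carré-du-champ bound) rather than its value.  Both are bookkeeping on top
of the variational floor, done once here in the `RevOp` format.

## What is proved (namespace `RevOp`; `C_g(k) = ∫ g (Kᵏ g) w`, `P = C_g(0)`, `ρ(k) = C_g(k)/P`,
`𝓔(v) = ∫ v² w − ∫ v (K v) w ≥ 0`)

* `autocov_pair_mul_pow_nonneg`, `abelSum_partial_nonneg`, **`abelSum_nonneg`** — the Abel sum is
  nonnegative: `0 ≤ Σ_{k≥0} C_g(k) rᵏ` for `0 ≤ r < 1` (pairs `r^{2m}(C(2m) + r C(2m+1)) ≥ 0` since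
  `|C(2m+1)| ≤ C(2m) = ‖Kᵐ g‖²`; no spectral theorem);
* `tauInt_ge_neg_half` — under summability `τ_int ≥ −½` (the resolvent form is nonnegative);
* **`tauInt_ge_variational_of_le`** — DOMINATED form: if the autocorrelation series of `g` is
  summable and `𝓔(v) ≤ E'`, then `τ_int(g) ≥ (∫ g v w)²/(P E') − ½` (no positivity needed: the
  case `𝓔(v) = 0` is the frozen-mode corollary `∫ g v w = 0`, and `x/0 = 0`);
* **`sq_inner_le_abelSum_mul_quadForm_thinned`** — per `V ≥ 1` steps, Abel form, unconditional:
  `(∫ g v w)² ≤ (Σ_{k≥0} C_g(Vk) rᵏ) · ((1 − r) ∫ v² w + r V 𝓔(v))`;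
* **`thinned_tauInt_ge_variational`** — if the `V`-thinned autocorrelation series of `g` is
  summable and `𝓔(v) ≤ E'`: **`τ_int^{(V)}(g) = ½ + Σ_{k≥1} ρ(Vk) ≥ (∫ g v w)² / (P · V E') − ½`**.

Reading: per sweep of `V` local proposals the variational floor loses exactly the factor `V` in the
Dirichlet form, as the locality floors of HOME/s0-phi4/CSD-THEOREMS.md do.  NOT CLAIMED: summability
for any sampler; non-reversible (ordered) sweeps.
-/

namespace Summit.Ventures.LatticeQCDFlow.Exactness

open Real MeasureTheory Filter Finset Topology
open Summit.Ventures.LatticeQCDFlow.Scoring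

namespace RevOp

variable {X : Type*} [MeasurableSpace X] {μ : Measure X} {w : X → ℝ} {A : (X → ℝ) → Prop}
  {K : (X → ℝ) → (X → ℝ)}

/-! ## The Abel sum is nonnegative -/

/-- **Weighted pair positivity**: `0 ≤ C(2m) r^{2m} + C(2m+1) r^{2m+1}` for `0 ≤ r ≤ 1`
(`C(2m) = ‖Kᵐg‖²`, `|C(2m+1)| = |⟨Kᵐg, K Kᵐg⟩| ≤ ‖Kᵐg‖²`). -/
theorem autocov_pair_mul_pow_nonneg (hw0 : ∀ x, 0 ≤ w x)
    (hAi : ∀ ⦃f h : X → ℝ⦄, A f → A h → Integrable (fun x => f x * h x * w x) μ)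
    (hAK : ∀ ⦃f : X → ℝ⦄, A f → A (K f))
    (hsymm : ∀ ⦃f h : X → ℝ⦄, A f → A h →
      ∫ x, K f x * h x * w x ∂μ = ∫ x, f x * K h x * w x ∂μ)
    (hcontr : ∀ ⦃f : X → ℝ⦄, A f → ∫ x, K f x ^ 2 * w x ∂μ ≤ ∫ x, f x ^ 2 * w x ∂μ)
    {g : X → ℝ} (hg : A g) {r : ℝ} (hr0 : 0 ≤ r) (hr1 : r ≤ 1) (m : ℕ) :
    0 ≤ (∫ x, g x * (K^[2 * m] g) x * w x ∂μ) * r ^ (2 * m)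
        + (∫ x, g x * (K^[2 * m + 1] g) x * w x ∂μ) * r ^ (2 * m + 1) := by
  have hu := iterate_mem hAK m hg
  have e0 : ∫ x, g x * (K^[2 * m] g) x * w x ∂μ = ∫ x, (K^[m] g) x ^ 2 * w x ∂μ := by
    rw [two_mul, ← two_time hAK hsymm hg m m]
    exact integral_congr_ae (Eventually.of_forall fun x => by ring)
  have e1 : ∫ x, g x * (K^[2 * m + 1] g) x * w x ∂μ
      = ∫ x, (K^[m] g) x * (K^[1] (K^[m] g)) x * w x ∂μ := by
    rw [show 2 * m + 1 = m + (m + 1) by ring, ← two_time hAK hsymm hg m (m + 1),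
      Function.iterate_one, ← Function.iterate_succ_apply' K m g]
  have hb := abs_autocov_le hw0 hAi hAK hcontr hu 1
  rw [← e1] at hb
  have hP0 : 0 ≤ ∫ x, (K^[m] g) x ^ 2 * w x ∂μ :=
    integral_nonneg fun x => mul_nonneg (sq_nonneg _) (hw0 x)
  rw [e0, pow_succ]
  have hlow := neg_abs_le (∫ x, g x * (K^[2 * m + 1] g) x * w x ∂μ)
  have hr2 : 0 ≤ r ^ (2 * m) := pow_nonneg hr0 _
  nlinarith [mul_nonneg hr2 (mul_nonneg (sub_nonneg.2 hr1) hP0), mul_nonneg hr2 hr0]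

/-- Partial Abel sums over whole pairs are nonnegative. -/
theorem abelSum_partial_nonneg (hw0 : ∀ x, 0 ≤ w x)
    (hAi : ∀ ⦃f h : X → ℝ⦄, A f → A h → Integrable (fun x => f x * h x * w x) μ)
    (hAK : ∀ ⦃f : X → ℝ⦄, A f → A (K f))
    (hsymm : ∀ ⦃f h : X → ℝ⦄, A f → A h →
      ∫ x, K f x * h x * w x ∂μ = ∫ x, f x * K h x * w x ∂μ)
    (hcontr : ∀ ⦃f : X → ℝ⦄, A f → ∫ x, K f x ^ 2 * w x ∂μ ≤ ∫ x, f x ^ 2 * w x ∂μ)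
    {g : X → ℝ} (hg : A g) {r : ℝ} (hr0 : 0 ≤ r) (hr1 : r ≤ 1) :
    ∀ N : ℕ, 0 ≤ ∑ k ∈ Finset.range (2 * N), (∫ x, g x * (K^[k] g) x * w x ∂μ) * r ^ k
  | 0 => by simp
  | N + 1 => by
    rw [show 2 * (N + 1) = 2 * N + 1 + 1 by ring, Finset.sum_range_succ, Finset.sum_range_succ]
    have h1 := abelSum_partial_nonneg hw0 hAi hAK hsymm hcontr hg hr0 hr1 N
    have h2 := autocov_pair_mul_pow_nonneg hw0 hAi hAK hsymm hcontr hg hr0 hr1 N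
    linarith

/-- **THE ABEL SUM IS NONNEGATIVE**: `0 ≤ Σ_{k≥0} C_g(k) rᵏ` for `0 ≤ r < 1` — the regularised
`H₋₁` form of a reversible contraction, without spectral theory. -/
theorem abelSum_nonneg (hw0 : ∀ x, 0 ≤ w x)
    (hAi : ∀ ⦃f h : X → ℝ⦄, A f → A h → Integrable (fun x => f x * h x * w x) μ)
    (hAK : ∀ ⦃f : X → ℝ⦄, A f → A (K f))
    (hsymm : ∀ ⦃f h : X → ℝ⦄, A f → A h →
      ∫ x, K f x * h x * w x ∂μ = ∫ x, f x * K h x * w x ∂μ)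
    (hcontr : ∀ ⦃f : X → ℝ⦄, A f → ∫ x, K f x ^ 2 * w x ∂μ ≤ ∫ x, f x ^ 2 * w x ∂μ)
    {g : X → ℝ} (hg : A g) {r : ℝ} (hr0 : 0 ≤ r) (hr1 : r < 1) :
    0 ≤ ∑' k, (∫ x, g x * (K^[k] g) x * w x ∂μ) * r ^ k := by
  have ht := (summable_autocov_mul_pow hw0 hAi hAK hcontr hg hr0 hr1).hasSum.tendsto_sum_nat
  have h2 : Tendsto (fun N : ℕ => 2 * N) atTop atTop :=
    tendsto_atTop_mono (fun N => Nat.le_mul_of_pos_left N two_pos) tendsto_id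
  exact ge_of_tendsto' (ht.comp h2)
    fun N => abelSum_partial_nonneg hw0 hAi hAK hsymm hcontr hg hr0 hr1.le N

/-! ## The dominated `τ_int` form -/

/-- Under summability `τ_int ≥ −½`: the resolvent form `Σ_{k≥0} C_g(k)` is nonnegative. -/
theorem tauInt_ge_neg_half (hw0 : ∀ x, 0 ≤ w x)
    (hAi : ∀ ⦃f h : X → ℝ⦄, A f → A h → Integrable (fun x => f x * h x * w x) μ)
    (hAK : ∀ ⦃f : X → ℝ⦄, A f → A (K f))
    (hsymm : ∀ ⦃f h : X → ℝ⦄, A f → A h →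
      ∫ x, K f x * h x * w x ∂μ = ∫ x, f x * K h x * w x ∂μ)
    (hcontr : ∀ ⦃f : X → ℝ⦄, A f → ∫ x, K f x ^ 2 * w x ∂μ ≤ ∫ x, f x ^ 2 * w x ∂μ)
    {g : X → ℝ} (hg : A g)
    (hs : Summable fun n => (∫ x, g x * (K^[n + 1] g) x * w x ∂μ) / ∫ x, g x ^ 2 * w x ∂μ) :
    -(1 / 2 : ℝ) ≤ tauInt (fun n => (∫ x, g x * (K^[n] g) x * w x ∂μ) / ∫ x, g x ^ 2 * w x ∂μ) := by
  set C : ℕ → ℝ := fun k => ∫ x, g x * (K^[k] g) x * w x ∂μ with hC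
  set P := ∫ x, g x ^ 2 * w x ∂μ with hPdef
  have hP0 : 0 ≤ P := integral_nonneg fun x => mul_nonneg (sq_nonneg _) (hw0 x)
  have htau : tauInt (fun n => C n / P) = 1 / 2 + ∑' k, C (k + 1) / P := by simp only [tauInt]
  rw [htau]
  rcases eq_or_lt_of_le hP0 with hz | hPpos
  · have hρ0 : ∀ k, C (k + 1) / P = 0 := fun k => by rw [← hz, div_zero]
    rw [tsum_congr hρ0, tsum_zero]
    norm_num
  · have hC0 : C 0 = P := by
      simp only [hC, hPdef, Function.iterate_zero, id_eq]
      exact integral_congr_ae (Eventually.of_forall fun x => by ring)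
    have hsC1 : Summable fun n => C (n + 1) := by
      refine (hs.mul_left P).congr fun n => ?_
      show P * (C (n + 1) / P) = C (n + 1)
      field_simp
    have hsC : Summable C := (summable_nat_add_iff 1).1 hsC1
    have hnn := tsum_nonneg hw0 hAi hAK hsymm hcontr hg hsC
    rw [hsC.tsum_eq_zero_add, hC0] at hnn
    have e : ∑' k, C (k + 1) / P = (∑' k, C (k + 1)) / P := tsum_div_const
    rw [e]
    have h1 : -1 ≤ (∑' k, C (k + 1)) / P := by
      rw [le_div_iff₀ hPpos]
      linarith
    linarith

/-- **THE DOMINATED VARIATIONAL FLOOR**: if the autocorrelation series of `g ∈ A` is summable and the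
trial observable `v ∈ A` has Dirichlet form `𝓔(v) ≤ E'`, then
`τ_int(g) ≥ (∫ g v w)² / (C_g(0) · E') − ½` (for `E' = 0`, Lean's `x/0 = 0` and `τ_int ≥ −½`). -/
theorem tauInt_ge_variational_of_le (hw0 : ∀ x, 0 ≤ w x)
    (hAi : ∀ ⦃f h : X → ℝ⦄, A f → A h → Integrable (fun x => f x * h x * w x) μ)
    (hAc : ∀ ⦃f h : X → ℝ⦄ (c : ℝ), A f → A h → A (fun x => f x + c * h x))
    (hAK : ∀ ⦃f : X → ℝ⦄, A f → A (K f))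
    (hlin : ∀ ⦃f h : X → ℝ⦄ (c : ℝ), A f → A h →
      ∀ x, K (fun s => f s + c * h s) x = K f x + c * K h x)
    (hsymm : ∀ ⦃f h : X → ℝ⦄, A f → A h →
      ∫ x, K f x * h x * w x ∂μ = ∫ x, f x * K h x * w x ∂μ)
    (hcontr : ∀ ⦃f : X → ℝ⦄, A f → ∫ x, K f x ^ 2 * w x ∂μ ≤ ∫ x, f x ^ 2 * w x ∂μ)
    {g v : X → ℝ} (hg : A g) (hv : A v)
    (hs : Summable fun n => (∫ x, g x * (K^[n + 1] g) x * w x ∂μ) / ∫ x, g x ^ 2 * w x ∂μ)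
    {E' : ℝ} (hle : (∫ x, v x ^ 2 * w x ∂μ) - ∫ x, v x * K v x * w x ∂μ ≤ E') :
    (∫ x, g x * v x * w x ∂μ) ^ 2 / ((∫ x, g x ^ 2 * w x ∂μ) * E') - 1 / 2
      ≤ tauInt (fun n => (∫ x, g x * (K^[n] g) x * w x ∂μ) / ∫ x, g x ^ 2 * w x ∂μ) := by
  set P := ∫ x, g x ^ 2 * w x ∂μ with hPdef
  set E := (∫ x, v x ^ 2 * w x ∂μ) - ∫ x, v x * K v x * w x ∂μ with hEdef
  set B := ∫ x, g x * v x * w x ∂μ with hB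
  have hP0 : 0 ≤ P := integral_nonneg fun x => mul_nonneg (sq_nonneg _) (hw0 x)
  have hE0 : 0 ≤ E := by
    have h := quadForm_nonneg hw0 hAi hAK hcontr hv zero_le_one (le_refl (1 : ℝ))
    simpa only [one_mul] using h
  have hhalf := tauInt_ge_neg_half hw0 hAi hAK hsymm hcontr hg hs
  rcases eq_or_lt_of_le hP0 with hzP | hPpos
  · have hfrac : B ^ 2 / (P * E') = 0 := by rw [← hzP, zero_mul, div_zero]
    rw [hfrac]
    linarith
  rcases eq_or_lt_of_le hE0 with hz | hEpos
  · have hB0 : B = 0 := inner_eq_zero_of_summable hw0 hAi hAc hAK hlin hsymm hcontr hg hv hs hz.symm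
    rw [hB0]
    norm_num
    linarith
  · have h := tauInt_ge_variational hw0 hAi hAc hAK hlin hsymm hcontr hg hv hs hEpos
    have hmono : B ^ 2 / (P * E') ≤ B ^ 2 / (P * E) :=
      div_le_div_of_nonneg_left (sq_nonneg _) (mul_pos hPpos hEpos)
        (mul_le_mul_of_nonneg_left hle hPpos.le)
    linarith

/-! ## Per `V` steps -/

/-- **THE VARIATIONAL FLOOR PER `V` STEPS (Abel form, unconditional)**: for `0 ≤ r < 1`, `V` steps,
`g, v ∈ A`:  `(∫ g v w)² ≤ (Σ_{k≥0} C_g(Vk) rᵏ) · ((1 − r) ∫ v² w + r V 𝓔(v))`. -/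
theorem sq_inner_le_abelSum_mul_quadForm_thinned (hw0 : ∀ x, 0 ≤ w x)
    (hAi : ∀ ⦃f h : X → ℝ⦄, A f → A h → Integrable (fun x => f x * h x * w x) μ)
    (hAc : ∀ ⦃f h : X → ℝ⦄ (c : ℝ), A f → A h → A (fun x => f x + c * h x))
    (hAK : ∀ ⦃f : X → ℝ⦄, A f → A (K f))
    (hlin : ∀ ⦃f h : X → ℝ⦄ (c : ℝ), A f → A h →
      ∀ x, K (fun s => f s + c * h s) x = K f x + c * K h x)
    (hsymm : ∀ ⦃f h : X → ℝ⦄, A f → A h →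
      ∫ x, K f x * h x * w x ∂μ = ∫ x, f x * K h x * w x ∂μ)
    (hcontr : ∀ ⦃f : X → ℝ⦄, A f → ∫ x, K f x ^ 2 * w x ∂μ ≤ ∫ x, f x ^ 2 * w x ∂μ)
    {g v : X → ℝ} (hg : A g) (hv : A v) {r : ℝ} (hr0 : 0 ≤ r) (hr1 : r < 1) (V : ℕ) :
    (∫ x, g x * v x * w x ∂μ) ^ 2
      ≤ (∑' k, (∫ x, g x * (K^[V * k] g) x * w x ∂μ) * r ^ k)
        * ((1 - r) * (∫ x, v x ^ 2 * w x ∂μ)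
          + r * (V * ((∫ x, v x ^ 2 * w x ∂μ) - ∫ x, v x * K v x * w x ∂μ))) := by
  -- the thinned operator `K^V` is again a reversible contraction on the class
  have hAK' : ∀ ⦃f : X → ℝ⦄, A f → A (K^[V] f) := fun f hf => iterate_mem hAK V hf
  have hlin' : ∀ ⦃f h : X → ℝ⦄ (c : ℝ), A f → A h →
      ∀ x, K^[V] (fun s => f s + c * h s) x = (K^[V] f) x + c * (K^[V] h) x :=
    fun f h c hf hh => iterate_add_mul hAK hlin c V hf hh
  have hsymm' : ∀ ⦃f h : X → ℝ⦄, A f → A h →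
      ∫ x, (K^[V] f) x * h x * w x ∂μ = ∫ x, f x * (K^[V] h) x * w x ∂μ :=
    fun f h hf hh => iterate_symm hAK hsymm V hf hh
  have hcontr' : ∀ ⦃f : X → ℝ⦄, A f → ∫ x, (K^[V] f) x ^ 2 * w x ∂μ ≤ ∫ x, f x ^ 2 * w x ∂μ :=
    fun f hf => iterate_contr hAK hcontr V hf
  have h := sq_inner_le_abelSum_mul_quadForm (K := K^[V]) hw0 hAi hAc hAK' hlin' hsymm' hcontr'
    hg hv hr0 hr1
  simp only [← Function.iterate_mul] at h
  have hA0 := abelSum_nonneg (K := K^[V]) hw0 hAi hAK' hsymm' hcontr' hg hr0 hr1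
  simp only [← Function.iterate_mul] at hA0
  have hdef := autocov_deficit_le hw0 hAi hAc hAK hlin hsymm hcontr hv V
  refine h.trans (mul_le_mul_of_nonneg_left ?_ hA0)
  nlinarith [hdef, hr0]

/-- **THE VARIATIONAL `τ_int` FLOOR PER `V` STEPS (dominated form).**  If the `V`-thinned
autocorrelation series `k ↦ ρ(Vk)` of `g ∈ A` is summable, then for every trial observable `v ∈ A`
with `𝓔(v) ≤ E'`:  `τ_int^{(V)}(g) = ½ + Σ_{k≥1} ρ(Vk) ≥ (∫ g v w)² / (C_g(0) · V E') − ½`. -/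
theorem thinned_tauInt_ge_variational (hw0 : ∀ x, 0 ≤ w x)
    (hAi : ∀ ⦃f h : X → ℝ⦄, A f → A h → Integrable (fun x => f x * h x * w x) μ)
    (hAc : ∀ ⦃f h : X → ℝ⦄ (c : ℝ), A f → A h → A (fun x => f x + c * h x))
    (hAK : ∀ ⦃f : X → ℝ⦄, A f → A (K f))
    (hlin : ∀ ⦃f h : X → ℝ⦄ (c : ℝ), A f → A h →
      ∀ x, K (fun s => f s + c * h s) x = K f x + c * K h x)
    (hsymm : ∀ ⦃f h : X → ℝ⦄, A f → A h →
      ∫ x, K f x * h x * w x ∂μ = ∫ x, f x * K h x * w x ∂μ)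
    (hcontr : ∀ ⦃f : X → ℝ⦄, A f → ∫ x, K f x ^ 2 * w x ∂μ ≤ ∫ x, f x ^ 2 * w x ∂μ)
    {g v : X → ℝ} (hg : A g) (hv : A v) (V : ℕ)
    (hs : Summable fun k => (∫ x, g x * (K^[V * (k + 1)] g) x * w x ∂μ) / ∫ x, g x ^ 2 * w x ∂μ)
    {E' : ℝ} (hle : (∫ x, v x ^ 2 * w x ∂μ) - ∫ x, v x * K v x * w x ∂μ ≤ E') :
    (∫ x, g x * v x * w x ∂μ) ^ 2 / ((∫ x, g x ^ 2 * w x ∂μ) * (V * E')) - 1 / 2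
      ≤ tauInt (fun k => (∫ x, g x * (K^[V * k] g) x * w x ∂μ) / ∫ x, g x ^ 2 * w x ∂μ) := by
  have hAK' : ∀ ⦃f : X → ℝ⦄, A f → A (K^[V] f) := fun f hf => iterate_mem hAK V hf
  have hlin' : ∀ ⦃f h : X → ℝ⦄ (c : ℝ), A f → A h →
      ∀ x, K^[V] (fun s => f s + c * h s) x = (K^[V] f) x + c * (K^[V] h) x :=
    fun f h c hf hh => iterate_add_mul hAK hlin c V hf hh
  have hsymm' : ∀ ⦃f h : X → ℝ⦄, A f → A h →
      ∫ x, (K^[V] f) x * h x * w x ∂μ = ∫ x, f x * (K^[V] h) x * w x ∂μ :=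
    fun f h hf hh => iterate_symm hAK hsymm V hf hh
  have hcontr' : ∀ ⦃f : X → ℝ⦄, A f → ∫ x, (K^[V] f) x ^ 2 * w x ∂μ ≤ ∫ x, f x ^ 2 * w x ∂μ :=
    fun f hf => iterate_contr hAK hcontr V hf
  have hs' : Summable fun n =>
      (∫ x, g x * ((K^[V])^[n + 1] g) x * w x ∂μ) / ∫ x, g x ^ 2 * w x ∂μ := by
    simpa only [← Function.iterate_mul] using hs
  have hdef := autocov_deficit_le hw0 hAi hAc hAK hlin hsymm hcontr hv V
  have hle' : (∫ x, v x ^ 2 * w x ∂μ) - ∫ x, v x * (K^[V] v) x * w x ∂μ ≤ V * E' :=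
    hdef.trans (mul_le_mul_of_nonneg_left hle (Nat.cast_nonneg V))
  have hfloor := tauInt_ge_variational_of_le (K := K^[V]) hw0 hAi hAc hAK' hlin' hsymm' hcontr'
    hg hv hs' hle'
  simp only [← Function.iterate_mul] at hfloor
  exact hfloor

end RevOp

end Summit.Ventures.LatticeQCDFlow.Exactness
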